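import Mathlib
import Summits.AtomisticToContinuum.Crystallization.Theorems.GappedShellCensusCleanLimitsHaveWindowsLayeredCaps

/-!
# Exactly layered shells ⇒ exactly layered set, file 5: one layer up, and the slab below it is empty

Crux `GappedShellCensus.CleanLimitsHaveWindows` (stmt-AtomisticToContinuum-15932), line `Sketch`, support for
`stub_layeredOfExactShells`.  Anchor `stub_layerStepUp`: above a complete layer `(L, z)` of a set `Z` with the gap
clause and exact bond shells there is a complete layer `(L ± 1, z + h)`, `0.78a ≤ h ≤ 0.85a`, and the only points of
`Z` with height in `[z, z + h)` are the sites of the layer `(L, z)`.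

Proof (`slab_exact`, shared with the downward step).  `stub_layerCaps` gives the upper layer at the cap height `h⁺`
and the heights of all bond-shell points of layer sites.  COVERING: every point `x` is within
`√(¾a'² + (height difference)²)` of a site of any layer (`near_layer_pt`: round the two lattice coordinates).  A
point of the slab at height `≤ z + h⁺/2` is thus within bond range of a site of the layer, hence that site or a
shell point of it, and the heights clause places it on the layer; a point at height `> z + h⁺/2` is within bond range
of a site of the UPPER layer, and the heights clause of `stub_layerCaps` applied to the upper layer (whose lower cap
depth is at least `0.78a`) excludes it.
-/

noncomputable section

namespace Summit.AtomisticToContinuum.Crystallization.Theorems.CleanHull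

open Literature.MathematicalPhysics.StatisticalMechanics

/-- **Cap heights are in `[0.78a, 0.85a]`**: if `a'` and `√(a'²/3 + h²)` are in the radial band then
`39a/50 ≤ h ≤ 17a/20`. [folklore] -/
theorem cap_height_bounds {a a' h : ℝ} (ha : 0 < a) (hh : 0 < h) (hlo : a * (1 - 1 / 50) ≤ a')
    (hhi : a' ≤ a * (1 + 1 / 50)) (b1 : (a * (1 - 1 / 50)) ^ 2 ≤ a' ^ 2 / 3 + h ^ 2)
    (b2 : a' ^ 2 / 3 + h ^ 2 ≤ (a * (1 + 1 / 50)) ^ 2) : 39 / 50 * a ≤ h ∧ h ≤ 17 / 20 * a := by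
  have h1 : a' ^ 2 ≤ (a * (1 + 1 / 50)) ^ 2 := pow_le_pow_left₀ (by linarith) hhi 2
  have h2 : (a * (1 - 1 / 50)) ^ 2 ≤ a' ^ 2 := pow_le_pow_left₀ (by positivity) hlo 2
  constructor
  · refine (pow_le_pow_iff_left₀ (by positivity) hh.le two_ne_zero).1 ?_
    linarith
  · refine (pow_le_pow_iff_left₀ hh.le (by positivity) two_ne_zero).1 ?_
    linarith

/-- **Covering radius of a layer.** Every point is within `√(¾ a'² + (height difference)²)` of a site of the layer
`p₀ + A (ℤ u + ℤ v + L w + z e₃)` (round the two lattice coordinates to the nearest integers). [folklore] -/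
theorem near_layer_pt (A : EuclideanSpace ℝ (Fin 3) →ₗᵢ[ℝ] EuclideanSpace ℝ (Fin 3)) (p₀ : EuclideanSpace ℝ (Fin 3))
    {a' : ℝ} (ha' : a' ≠ 0) (L : ℤ) (z : ℝ) (x : EuclideanSpace ℝ (Fin 3)) :
    ∃ i j : ℤ, dist (A (((i : ℝ) • triangularVec₁ a') + ((j : ℝ) • triangularVec₂ a') +
        ((L : ℝ) • barlowOffset a') + (z • layerNormal 1)) + p₀) x ^ 2 ≤
      3 / 4 * a' ^ 2 + (inner ℝ (x - p₀) (A (layerNormal 1)) - z) ^ 2 := by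
  obtain ⟨y, hy⟩ : ∃ y, A y = x - p₀ :=
    ⟨(A.toLinearIsometryEquiv rfl).symm (x - p₀), (A.toLinearIsometryEquiv rfl).apply_symm_apply _⟩
  have h3 : Real.sqrt 3 ≠ 0 := by positivity
  obtain ⟨α, β, γ, rfl⟩ : ∃ α β γ : ℝ, y = α • triangularVec₁ a' + β • triangularVec₂ a' + γ • layerNormal 1 := by
    refine ⟨y 0 / a' - y 1 / (a' * Real.sqrt 3), 2 * y 1 / (a' * Real.sqrt 3), y 2, ?_⟩
    ext l
    fin_cases l
    · simp [triangularVec₁, triangularVec₂, layerNormal]; field_simp; ring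
    · simp [triangularVec₁, triangularVec₂, layerNormal]; field_simp
    · simp [triangularVec₁, triangularVec₂, layerNormal]
  have hx : x = A (α • triangularVec₁ a' + β • triangularVec₂ a' + γ • layerNormal 1) + p₀ := by
    rw [hy, sub_add_cancel]
  have hw : barlowOffset a' = (1 / 3 : ℝ) • (triangularVec₁ a' + triangularVec₂ a') := by
    rw [← three_smul_barlowOffset, smul_smul]; norm_num
  refine ⟨round (α - L / 3), round (β - L / 3), ?_⟩
  have hd1 := abs_le.1 (abs_sub_round (α - L / 3))
  have hd2 := abs_le.1 (abs_sub_round (β - L / 3))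
  set n₁ : ℤ := round (α - L / 3) with hn₁
  set n₂ : ℤ := round (β - L / 3) with hn₂
  rw [hx, dist_add_right, A.dist_map, add_sub_cancel_right, A.inner_map_map, la_inner_layerNormal, dist_eq_norm]
  have hdiff : ((n₁ : ℝ) • triangularVec₁ a' + (n₂ : ℝ) • triangularVec₂ a' + (L : ℝ) • barlowOffset a' + z • layerNormal 1) -
      (α • triangularVec₁ a' + β • triangularVec₂ a' + γ • layerNormal 1) =
      ((n₁ : ℝ) - α + L / 3) • triangularVec₁ a' + ((n₂ : ℝ) - β + L / 3) • triangularVec₂ a' + (z - γ) • layerNormal 1 := by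
    rw [hw]; module
  rw [hdiff, la_norm_sq]
  have hq : ((n₁ : ℝ) - α + L / 3) ^ 2 + ((n₁ : ℝ) - α + L / 3) * ((n₂ : ℝ) - β + L / 3) + ((n₂ : ℝ) - β + L / 3) ^ 2 ≤
      3 / 4 := by
    nlinarith [hd1.1, hd1.2, hd2.1, hd2.2]
  nlinarith [mul_le_mul_of_nonneg_left hq (sq_nonneg a')]

/-- **Slab exactness.** If the layer `(L, z)` is complete, the layer `(L + ε, z + h⁺)` is complete, `h⁺ ≤ 0.85a`, and
every bond-shell point of a site of the layer `(L, z)` is a site of that layer or has height `z + h⁺` or `z - h⁻`,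
then the only points of `Z` with height in `[z, z + h⁺)` are the sites of the layer `(L, z)`. [folklore] -/
theorem slab_exact (Z : Set (EuclideanSpace ℝ (Fin 3))) (a : ℝ) (ha : 0 < a)
    (hgap : ∀ y ∈ Z, ∀ w ∈ Z, w ≠ y → a * (1 - 1 / 50) ≤ dist y w ∧
      (dist y w ≤ a * (1 + 1 / 50) ∨ a * (63 / 50) ≤ dist y w))
    (hexact : ∀ p ∈ Z, ∃ (a' hp' hm' : ℝ) (A : EuclideanSpace ℝ (Fin 3) →ₗᵢ[ℝ] EuclideanSpace ℝ (Fin 3)),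
      0 < a' ∧ 0 < hp' ∧ 0 < hm' ∧
      ((bondShell a Z p = Set.range fun k : Fin 12 => p + A (slotC a' hp' hm' k)) ∨
       (bondShell a Z p = Set.range fun k : Fin 12 => p + A (slotH a' hp' hm' k))))
    (p₀ : EuclideanSpace ℝ (Fin 3)) (a' : ℝ) (A : EuclideanSpace ℝ (Fin 3) →ₗᵢ[ℝ] EuclideanSpace ℝ (Fin 3))
    (hlo : a * (1 - 1 / 50) ≤ a') (hhi : a' ≤ a * (1 + 1 / 50)) (L : ℤ) (z : ℝ) (ε : ℤ) (hp hm : ℝ)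
    (hpos : 0 < hp) (hmpos : 0 < hm) (hple : hp ≤ 17 / 20 * a)
    (hup : ∀ i j : ℤ, A (((i : ℝ) • triangularVec₁ a') + ((j : ℝ) • triangularVec₂ a') +
      (((L + ε : ℤ) : ℝ) • barlowOffset a') + ((z + hp) • layerNormal 1)) + p₀ ∈ Z)
    (H0 : ∀ i j : ℤ, ∀ x ∈ bondShell a Z (A (((i : ℝ) • triangularVec₁ a') + ((j : ℝ) • triangularVec₂ a') +
        ((L : ℝ) • barlowOffset a') + (z • layerNormal 1)) + p₀),
      (inner ℝ (x - p₀) (A (layerNormal 1)) = z ∧ ∃ i' j' : ℤ,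
          x = A (((i' : ℝ) • triangularVec₁ a') + ((j' : ℝ) • triangularVec₂ a') +
            ((L : ℝ) • barlowOffset a') + (z • layerNormal 1)) + p₀) ∨
        inner ℝ (x - p₀) (A (layerNormal 1)) = z + hp ∨ inner ℝ (x - p₀) (A (layerNormal 1)) = z - hm) :
    ∀ x ∈ Z, z ≤ inner ℝ (x - p₀) (A (layerNormal 1)) → inner ℝ (x - p₀) (A (layerNormal 1)) < z + hp →
      ∃ i j : ℤ, x = A (((i : ℝ) • triangularVec₁ a') + ((j : ℝ) • triangularVec₂ a') +
        ((L : ℝ) • barlowOffset a') + (z • layerNormal 1)) + p₀ := by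
  intro x hx hz1 hz2
  have ha' : 0 < a' := lt_of_lt_of_le (by positivity) hlo
  have hsq : a' ^ 2 ≤ (a * (1 + 1 / 50)) ^ 2 := pow_le_pow_left₀ ha'.le hhi 2
  have ha2 : 0 < a ^ 2 := by positivity
  have h102 : (0 : ℝ) ≤ a * (1 + 1 / 50) := by positivity
  by_cases hc : inner ℝ (x - p₀) (A (layerNormal 1)) - z ≤ hp / 2
  · -- near a site of the layer
    obtain ⟨i, j, hd⟩ := near_layer_pt A p₀ ha'.ne' L z x
    have hd' : dist (A (((i : ℝ) • triangularVec₁ a') + ((j : ℝ) • triangularVec₂ a') +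
        ((L : ℝ) • barlowOffset a') + (z • layerNormal 1)) + p₀) x ≤ a * (1 + 1 / 50) := by
      refine (pow_le_pow_iff_left₀ dist_nonneg h102 two_ne_zero).1 ?_
      have h2 : (inner ℝ (x - p₀) (A (layerNormal 1)) - z) ^ 2 ≤ (17 / 40 * a) ^ 2 :=
        pow_le_pow_left₀ (by linarith) (by linarith) 2
      linarith
    by_cases hxe : x = A (((i : ℝ) • triangularVec₁ a') + ((j : ℝ) • triangularVec₂ a') +
        ((L : ℝ) • barlowOffset a') + (z • layerNormal 1)) + p₀
    · exact ⟨i, j, hxe⟩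
    · rcases H0 i j x ⟨hx, hxe, hd'⟩ with ⟨-, i', j', e⟩ | h | h
      · exact ⟨i', j', e⟩
      · linarith
      · linarith
  · -- near a site of the upper layer: excluded by the heights clause there
    exfalso
    push Not at hc
    obtain ⟨εp', εm', hp', hm', -, -, hpos', hmpos', -, -, b3', b4', -, -, H1⟩ :=
      stub_layerCaps Z a ha hgap hexact p₀ a' A hlo hhi (L + ε) (z + hp) hup
    obtain ⟨hm'lo, -⟩ := cap_height_bounds ha hmpos' hlo hhi b3' b4'
    obtain ⟨i, j, hd⟩ := near_layer_pt A p₀ ha'.ne' (L + ε) (z + hp) x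
    have hd' : dist (A (((i : ℝ) • triangularVec₁ a') + ((j : ℝ) • triangularVec₂ a') +
        (((L + ε : ℤ) : ℝ) • barlowOffset a') + ((z + hp) • layerNormal 1)) + p₀) x ≤ a * (1 + 1 / 50) := by
      refine (pow_le_pow_iff_left₀ dist_nonneg h102 two_ne_zero).1 ?_
      have h2 : (inner ℝ (x - p₀) (A (layerNormal 1)) - (z + hp)) ^ 2 < (17 / 40 * a) ^ 2 := by
        nlinarith
      linarith
    have hxe : x ≠ A (((i : ℝ) • triangularVec₁ a') + ((j : ℝ) • triangularVec₂ a') +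
        (((L + ε : ℤ) : ℝ) • barlowOffset a') + ((z + hp) • layerNormal 1)) + p₀ := by
      intro h
      rw [h, add_sub_cancel_right, A.inner_map_map, inner_layerVec_layerNormal] at hz2
      linarith
    rcases H1 i j x ⟨hx, hxe, hd'⟩ with ⟨h, -⟩ | h | h
    · linarith
    · linarith
    · linarith

/-- **Layer step, upwards.** Above a complete layer `(L, z)` (spacing `a'` in the band) of a set `Z` with the gap
clause all of whose bond shells are exact slot models there is a complete layer `(L + ε, z + h)`, `ε = ±1`,
`39a/50 ≤ h ≤ 17a/20`, and every point of `Z` with height in `[z, z + h)` is a site of the layer `(L, z)`.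
[folklore] -/
theorem stub_layerStepUp (Z : Set (EuclideanSpace ℝ (Fin 3))) (a : ℝ) (ha : 0 < a)
    (hgap : ∀ y ∈ Z, ∀ w ∈ Z, w ≠ y → a * (1 - 1 / 50) ≤ dist y w ∧
      (dist y w ≤ a * (1 + 1 / 50) ∨ a * (63 / 50) ≤ dist y w))
    (hexact : ∀ p ∈ Z, ∃ (a' hp' hm' : ℝ) (A : EuclideanSpace ℝ (Fin 3) →ₗᵢ[ℝ] EuclideanSpace ℝ (Fin 3)),
      0 < a' ∧ 0 < hp' ∧ 0 < hm' ∧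
      ((bondShell a Z p = Set.range fun k : Fin 12 => p + A (slotC a' hp' hm' k)) ∨
       (bondShell a Z p = Set.range fun k : Fin 12 => p + A (slotH a' hp' hm' k))))
    (p₀ : EuclideanSpace ℝ (Fin 3)) (a' : ℝ) (A : EuclideanSpace ℝ (Fin 3) →ₗᵢ[ℝ] EuclideanSpace ℝ (Fin 3))
    (hlo : a * (1 - 1 / 50) ≤ a') (hhi : a' ≤ a * (1 + 1 / 50)) (L : ℤ) (z : ℝ)
    (hlayer : ∀ i j : ℤ, A (((i : ℝ) • triangularVec₁ a') + ((j : ℝ) • triangularVec₂ a') +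
      ((L : ℝ) • barlowOffset a') + (z • layerNormal 1)) + p₀ ∈ Z) :
    ∃ (ε : ℤ) (h : ℝ), (ε = 1 ∨ ε = -1) ∧ 39 / 50 * a ≤ h ∧ h ≤ 17 / 20 * a ∧
      (∀ i j : ℤ, A (((i : ℝ) • triangularVec₁ a') + ((j : ℝ) • triangularVec₂ a') +
        (((L + ε : ℤ) : ℝ) • barlowOffset a') + ((z + h) • layerNormal 1)) + p₀ ∈ Z) ∧
      (∀ x ∈ Z, z ≤ inner ℝ (x - p₀) (A (layerNormal 1)) → inner ℝ (x - p₀) (A (layerNormal 1)) < z + h →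
        ∃ i j : ℤ, x = A (((i : ℝ) • triangularVec₁ a') + ((j : ℝ) • triangularVec₂ a') +
          ((L : ℝ) • barlowOffset a') + (z • layerNormal 1)) + p₀) := by
  obtain ⟨εp, εm, hp, hm, hεp, -, hpos, hmpos, b1, b2, -, -, hup, -, H0⟩ :=
    stub_layerCaps Z a ha hgap hexact p₀ a' A hlo hhi L z hlayer
  obtain ⟨hplo, hphi⟩ := cap_height_bounds ha hpos hlo hhi b1 b2
  exact ⟨εp, hp, hεp, hplo, hphi, hup,
    slab_exact Z a ha hgap hexact p₀ a' A hlo hhi L z εp hp hm hpos hmpos hphi hup H0⟩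

end Summit.AtomisticToContinuum.Crystallization.Theorems.CleanHull

end
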